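import Mathlib
import HarnessLib
import Summits.QuantumFields.YangMills.Theorems.U1DipoleHelicityBogoliubov
import Summits.QuantumFields.YangMills.Theorems.U1DipoleHelicitySecondMomentUpper

/-!
# A parity-free LOWER bound on the plaquette second moment of Wilson `U(1)₄` limit states

Route `U1DipoleHelicity` (LINE 4 of the ideator cell ym-idea-2; an abelian COMPARISON line onto the
node `Theorems.U1HelicityGapD4`, not a rung of `YangMills`), helper for the crux item
stmt-QuantumFields-25881 `Theses.U1DipoleHelicity.WilsonU1PlaquetteSecondMomentD4`
(`|2β⟨sin²θ_{(0;0,1)}⟩_μ − 1| ≤ ε`).  From the torus engine `U1DipoleHelicityBogoliubov`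
(`sq_meanPlaq_le_six_mul`: `⟨cos θ_p⟩² ≤ 6β⟨sin²θ_p⟩` on every torus of side `≥ 2`, no parity
restriction) and the tree's one-point theorem at weak coupling (`SoloBlind.weakCoupling_singlePlaquette`:
`⟨cos θ_p⟩_{Λ_{M+1},β} ≥ 1 − 5/(4β)` for large `β`, then large `M`):

* `torusPlaqSinSq_eventually_ge` — `2β⟨sin²θ_{(0;0,1)}⟩_{Λ_{M+1},β} ≥ 1/3 − ε` for `β > β₁(ε)`, all large `M`;
* `wilsonU1PlaquetteSecondMoment_lower_third` — for every weak-coupling infinite-volume torus limit state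
  `μ`, `2β · U1Helicity.plaqCorr μ 0 0 1 ≥ 1/3 − ε` (limit along the defining tori,
  `tendsto_torusPlaqSinSq`).

Together with `wilsonU1PlaquetteSecondMoment_upper` this pins `2β⟨sin²θ_p⟩_μ ∈ [1/3 − ε, 1 + ε]` on
limit states of EVERY parity; the optimal test form in the Bogoliubov inequality (diagonal of the
projection onto exact 2-forms, `(|Λ|−1)/(2|Λ|)`) would close the crux's lower half `1 − ε`.
Nothing here bears on the Yang–Mills mass gap.
-/

noncomputable section

namespace Summit.QuantumFields.YangMills.Theorems.U1DipoleHelicity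

open MeasureTheory Filter Topology Finset
open Literature.MathematicalPhysics.QuantumLattice Literature.MathematicalPhysics.QuantumFieldTheory
open Summit.QuantumFields.YangMills.Theorems.U1Helicity

/-! ### Limit states: `2β⟨sin²θ_p⟩_μ ≥ 1/3 − ε` -/

/-- **Torus form, uniform in the volume**: for every `ε > 0` there is `β₁` such that for every
`β > β₁`, `2β⟨sin²θ_{(0;0,1)}⟩_{Λ_{M+1},β} ≥ 1/3 − ε` for all large `M`. [folklore] -/
theorem torusPlaqSinSq_eventually_ge :
    ∀ ε : ℝ, 0 < ε → ∃ β₁ : ℝ, ∀ β : ℝ, β₁ < β → ∀ᶠ M : ℕ in atTop,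
      1 / 3 - ε ≤ 2 * β * wilsonExpectation (L := M + 1) u1Rep β
        (toTorusObservable (M + 1) (fun U : LGConfig 4 Circle => u1PlaqIm 0 0 1 U * u1PlaqIm 0 0 1 U)) := by
  intro ε hε
  have hsp := SoloBlind.weakCoupling_singlePlaquette (d := 4) u1Rep (by norm_num) le_rfl
    isUnitaryModel_u1Rep 1 one_pos
  have hβ := hsp.and (eventually_ge_atTop (max 2 (2 / ε)))
  obtain ⟨β₁, hβ₁⟩ := Filter.eventually_atTop.1 hβ
  refine ⟨β₁, fun β hb => ?_⟩
  obtain ⟨hL, hβε⟩ := hβ₁ β hb.le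
  have hb0 : 2 ≤ β := le_trans (le_max_left _ _) hβε
  have hβε' : 2 / ε ≤ β := le_trans (le_max_right _ _) hβε
  filter_upwards [hL, eventually_ge_atTop 1] with M hM hM1
  haveI : Fact (1 < M + 1) := ⟨by omega⟩
  -- the mean cosine `m ≥ 1 − 5/(4β)`
  have h := (abs_le.1 (hM (0 : Site 4 (M + 1)) 0 1 (by decide))).2
  set m : ℝ := wilsonExpectation (L := M + 1) u1Rep β
    (fun U : GaugeConfig 4 (M + 1) Circle => ((plaquetteHolonomy U 0 0 1 : Circle) : ℂ).re) with hm
  have hcost : wilsonExpectation (L := M + 1) u1Rep β (SoloBlind.plaquetteCost u1Rep (0 : Site 4 (M + 1)) 0 1) =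
      1 - m := by
    haveI := isProbabilityMeasure_wilsonMeasure (d := 4) (L := M + 1) (G := Circle) u1Rep continuous_u1Rep β
    simp only [hm, wilsonExpectation, SoloBlind.plaquetteCost, trace_u1Rep_re, Nat.cast_one]
    rw [integral_sub (integrable_const _) (integrable_wilson_of_continuous β (continuous_plaquette_re 0 0 1)),
      integral_const, probReal_univ, one_smul]
  rw [hcost] at h
  norm_num at h
  -- h : β * (1 - m) ≤ 5/4 (normalised); hence m ≥ 1 - 5/(4β)
  have hβpos : 0 < β := by linarith
  have hm_ge : 1 - 5 / (4 * β) ≤ m := by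
    have h54 : β * (1 - m) ≤ 5 / 4 := by linarith
    rw [sub_le_comm, le_div_iff₀ (by positivity)]
    linarith
  -- the torus observable is `sin² θ_{(0;0,1)}`
  have hobs : wilsonExpectation (L := M + 1) u1Rep β
      (toTorusObservable (M + 1) (fun U : LGConfig 4 Circle => u1PlaqIm 0 0 1 U * u1PlaqIm 0 0 1 U)) =
      wilsonExpectation (L := M + 1) u1Rep β
        (fun U : GaugeConfig 4 (M + 1) Circle => ((plaquetteHolonomy U 0 0 1 : Circle) : ℂ).im ^ 2) := by
    simp only [wilsonExpectation, toTorusObservable_apply, u1PlaqIm, plaquette_torusLift,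
      Literature.MathematicalPhysics.QuantumFieldTheory.torusProj_zero, sq]
  rw [hobs]
  have hbog := sq_meanPlaq_le_six_mul (L := M + 1) hβpos.le (0 : Site 4 (M + 1))
  rw [← hm] at hbog
  -- from `m² ≤ 6 β S` and `m ≥ 1 − 5/(4β) ≥ 0`, `β ≥ 2/ε`: `2βS ≥ m²/3 ≥ (1 − 5/(4β))²/3 ≥ 1/3 − ε`
  set δ : ℝ := 5 / (4 * β) with hδ
  have hm0 : 0 ≤ 1 - δ := by
    rw [hδ, sub_nonneg, div_le_one (by positivity)]; linarith
  have hm2 : (1 - δ) ^ 2 ≤ m ^ 2 := pow_le_pow_left₀ hm0 hm_ge 2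
  have hinv : δ ≤ ε := by
    rw [hδ, div_le_iff₀ (by positivity)]
    have := (div_le_iff₀ hε).1 hβε'
    nlinarith
  have h3 : m ^ 2 ≤ 3 * (2 * β * wilsonExpectation (L := M + 1) u1Rep β
      (fun U : GaugeConfig 4 (M + 1) Circle => ((plaquetteHolonomy U 0 0 1 : Circle) : ℂ).im ^ 2)) := by
    linarith
  nlinarith [hm2, h3, hinv, hm0, sq_nonneg δ, hε]

variable {β : ℝ} {μ : Measure (LGConfig 4 Circle)}

/-- **A parity-free lower bound for the crux `WilsonU1PlaquetteSecondMomentD4`**: for every `ε > 0`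
there is `β₁` such that every infinite-volume torus limit state `μ` of Wilson `U(1)₄` at `β > β₁`
satisfies `2β·⟨sin²θ_{(0;0,1)}⟩_μ ≥ 1/3 − ε` (single-edge Bogoliubov bound; the optimal test form would
give `1 − ε`, see the file header). [folklore] -/
theorem wilsonU1PlaquetteSecondMoment_lower_third :
    ∀ ε : ℝ, 0 < ε → ∃ β₁ : ℝ, ∀ β : ℝ, β₁ < β →
      ∀ μ ∈ infiniteVolumeLimitPoints (d := 4) u1Rep β, 1 / 3 - ε ≤ 2 * β * plaqCorr μ 0 0 1 := by
  intro ε hε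
  obtain ⟨β₁, hβ₁⟩ := torusPlaqSinSq_eventually_ge ε hε
  refine ⟨β₁, fun β hb μ hμ => ?_⟩
  obtain ⟨φ, hφ, hlim⟩ := hμ
  have ht := (tendsto_torusPlaqSinSq hlim).const_mul (2 * β)
  refine ge_of_tendsto ht ?_
  exact hφ.tendsto_atTop.eventually (hβ₁ β hb)

end Summit.QuantumFields.YangMills.Theorems.U1DipoleHelicity
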